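import Literature.AlgebraicGeometry.HodgeTheory.FermatHodgeCharacterCriterion
import HarnessLib

/-!
# The Hodge condition at an even conductor met at the exact levels `f`, `2f` — Aoki 1983, Prop. 2.2

Topic `Literature/AlgebraicGeometry/HodgeTheory`. THEOREMS only (no definition, no named fact, no `sorry`).
Support file (XXII), the even-conductor companion of `FermatHodgeCharacterExactLevel` (XVIII: odd `f`,
levels `f`, `2f`, where the level `2f` carries the Euler factor `1 - χ(2)` and the same weight) and of
`FermatHodgeCharacterQuarterLevel` (XX, `IsHodge.rel_max_level_conj`: any `f`, level `f` only): here `f`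
is EVEN, so `χ(2) = 0`, the Euler factors are trivial, and the weights differ (`φ(2f) = 2φ(f)`). This is
the relation behind Aoki's treatment of [Aoki1983, Thm. C] at the levels with `ord₂ m ≥ 3` (§9 (I-2),
(III-7) first paragraph: "`τ₂(α) = 2(1, b', c') ∈ A(m')` if `d_c = 2`, `2(1, b') ∈ A(m')` if `d_c ≠ 2`",
(V-1), (V-4) (9.4): "`τ₂(α) = 2(a₀', a₁') ∈ A(m/2)`"; route K₈ of the cell's scoping document).

For a Hodge character `α : Fin r → ℤ/m`, `αᵢ = (m/Mᵢ) wᵢ` (`Mᵢ ∣ m` the exact level, `wᵢ` a unit mod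
`Mᵢ`), an EVEN `f ∣ m` such that every `Mᵢ` divisible by `f` is `f` or `2f`, and an odd primitive character
`χ` mod `f` — **`IsHodge.rel_even_half_conj`** — `∑_{Mᵢ = 2f} χ(w̄ᵢ) + 2 ∑_{Mᵢ = f} χ(w̄ᵢ) = 0`
(`w̄ᵢ = wᵢ mod f`; weights `φ(m)/φ(2f) : φ(m)/φ(f) = 1 : 2`, Euler factors `1`; complex conjugate form).

HONEST FRAMING (cell `pub-hfermat`): explicit algebraic cycles for specific Hodge classes on
Fermat/Delsarte varieties; residual open instances listed; no claim on general Hodge. (Surface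
classes are algebraic by Lefschetz (1,1); this file is a relation among Hodge characters, no case
of HC.)

## References
* [Aoki1983] N. Aoki, *On some arithmetic problems related to the Hodge cycles on the Fermat varieties*,
  Math. Ann. 266 (1983) 23–54 — Props. 2.1, 2.2 (pp. 28–29), §9 (III-7) p. 50, (V-4) (9.4) p. 54.
-/

noncomputable section

open Finset

namespace Literature.AlgebraicGeometry.HodgeTheory

namespace FermatCharacter

section EvenHalf

variable {m : ℕ}

/-- `χ` vanishes at the primes of its level: `∏_{p ∣ f} (1 - χ(p)) = 1`. [folklore] -/
private theorem prod_primeFactors_one_sub_eq_one'' {f : ℕ} (χ : DirichletCharacter ℂ f) :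
    ∏ p ∈ f.primeFactors, (1 - χ (p : ZMod f)) = 1 := by
  refine Finset.prod_eq_one fun p hp ↦ ?_
  have hpf : p ∣ f := Nat.dvd_of_mem_primeFactors hp
  have hp1 : p.Prime := Nat.prime_of_mem_primeFactors hp
  have hnu : ¬ IsUnit ((p : ℕ) : ZMod f) := by
    rw [ZMod.isUnit_iff_coprime]
    intro hc
    exact hp1.one_lt.ne' (Nat.Coprime.eq_one_of_dvd hc hpf)
  rw [χ.map_nonunit hnu, sub_zero]

/-- **[Aoki1983, Prop. 2.2] at an EVEN conductor met only at the exact levels `f`, `2f`.** Let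
`α = (α₀, …, α_{r-1})` be a Hodge character of level `m`, `αᵢ = (m/Mᵢ) wᵢ` with `Mᵢ ∣ m` and `wᵢ` a
unit mod `Mᵢ`, and let `f ∣ m` be EVEN such that every `Mᵢ` divisible by `f` is `f` or `2f`. Then for
every odd primitive character `χ` mod `f`: `∑_{Mᵢ = 2f} (χ w̄ᵢ)⁻¹ + 2 ∑_{Mᵢ = f} (χ w̄ᵢ)⁻¹ = 0`
(`w̄ᵢ = wᵢ mod f`; the weights are `φ(m)/φ(2f) = c/2` and `φ(m)/φ(f) = c` since `φ(2f) = 2φ(f)` for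
even `f`; the Euler factors `∏_{p ∣ Mᵢ}(1 - χ(p))` are `1` because every prime of `2f` divides `f`).
[cite: Aoki1983, Prop. 2.2 with Prop. 2.1; §9 (V-4) (9.4) p. 54] -/
theorem IsHodge.rel_even_half [NeZero m] {r : ℕ} {α : Fin r → ZMod m} (h : IsHodge α)
    {f : ℕ} [NeZero f] (h2 : 2 ∣ f) (hfm : f ∣ m) {χ : DirichletCharacter ℂ f} (hχ : χ.Odd)
    (hprim : χ.IsPrimitive) (M : Fin r → ℕ) [∀ i, NeZero (M i)] (hM : ∀ i, M i ∣ m)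
    (w : (i : Fin r) → ZMod (M i)) (hw : ∀ i, IsUnit (w i))
    (hα : ∀ i, α i = ((m / M i : ℕ) : ZMod m) * ((ZMod.val (w i) : ℕ) : ZMod m))
    (hlev : ∀ i, f ∣ M i → M i = f ∨ M i = 2 * f) :
    ∑ i, (if M i = 2 * f then (χ (ZMod.cast (w i) : ZMod f))⁻¹
      else if M i = f then 2 * (χ (ZMod.cast (w i) : ZMod f))⁻¹ else 0) = 0 := by
  classical
  have hm0 : m ≠ 0 := NeZero.ne m
  have hf0 : f ≠ 0 := NeZero.ne f
  have key := h.aoki_criterion hfm hχ hprim M hM w hw hα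
  have hφf : ((f.totient : ℕ) : ℂ) ≠ 0 := by
    exact_mod_cast (Nat.totient_pos.mpr (Nat.pos_of_ne_zero hf0)).ne'
  set c : ℂ := (m.totient : ℂ) / (f.totient : ℂ) with hc
  have hc0 : c ≠ 0 := div_ne_zero
    (by exact_mod_cast (Nat.totient_pos.mpr (Nat.pos_of_ne_zero hm0)).ne') hφf
  have hne12 : f ≠ 2 * f := by omega
  have h2mem : (2 : ℕ) ∈ f.primeFactors := Nat.mem_primeFactors.mpr ⟨Nat.prime_two, h2, hf0⟩
  have hterm : ∀ i, (if f ∣ M i then ((m.totient : ℂ) / ((M i).totient : ℂ)) *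
        (∏ p ∈ (M i).primeFactors, (1 - χ p)) * (χ (ZMod.cast (w i) : ZMod f))⁻¹ else 0) =
      (c / 2) * (if M i = 2 * f then (χ (ZMod.cast (w i) : ZMod f))⁻¹
        else if M i = f then 2 * (χ (ZMod.cast (w i) : ZMod f))⁻¹ else 0) := by
    intro i
    by_cases hfi : f ∣ M i
    · rw [if_pos hfi]
      rcases hlev i hfi with h1 | h2'
      · -- exact level `f`
        have ht : ((M i).totient : ℂ) = f.totient := by rw [h1]
        have hp : ∏ p ∈ (M i).primeFactors, (1 - χ (p : ZMod f)) = 1 := by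
          rw [h1]; exact prod_primeFactors_one_sub_eq_one'' χ
        rw [ht, hp, if_neg (by rw [h1]; exact hne12), if_pos h1, hc]
        ring
      · -- exact level `2f`
        have ht : ((M i).totient : ℂ) = 2 * f.totient := by
          rw [h2', Nat.totient_mul_of_prime_of_dvd Nat.prime_two h2]; push_cast; ring
        have hp : ∏ p ∈ (M i).primeFactors, (1 - χ (p : ZMod f)) = 1 := by
          rw [h2', Nat.primeFactors_mul two_ne_zero hf0, Nat.prime_two.primeFactors,
            show ({2} ∪ f.primeFactors : Finset ℕ) = insert 2 f.primeFactors from rfl,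
            Finset.insert_eq_of_mem h2mem]
          exact prod_primeFactors_one_sub_eq_one'' χ
        rw [ht, hp, if_pos h2', hc]
        field_simp
    · have hne2 : ¬ M i = 2 * f := fun h2' ↦ hfi (h2' ▸ dvd_mul_left f 2)
      have hne1 : ¬ M i = f := fun h1 ↦ hfi (h1 ▸ dvd_refl f)
      rw [if_neg hfi, if_neg hne2, if_neg hne1, mul_zero]
  rw [Finset.sum_congr rfl (fun i _ ↦ hterm i), ← Finset.mul_sum] at key
  exact (mul_eq_zero.mp key).resolve_left (div_ne_zero hc0 two_ne_zero)

/-- **[Aoki1983, Prop. 2.2] at an even conductor met at the exact levels `f`, `2f` — with character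
values.** Under the hypotheses of `IsHodge.rel_even_half`:
`∑_{Mᵢ = 2f} χ(w̄ᵢ) + 2 ∑_{Mᵢ = f} χ(w̄ᵢ) = 0` for every odd primitive `χ` mod `f` (complex conjugate
of `rel_even_half`, `|χ(u)| = 1` on units): the points of level `2f` are single points of weight `1`,
those of level `f` single points of weight `2` — Aoki's "`τ₂(α) = 2(1, b', c') ∈ A(m')`".
[cite: Aoki1983, Prop. 2.2; §9 (III-7) p. 50, (V-4) (9.4) p. 54] -/
theorem IsHodge.rel_even_half_conj [NeZero m] {r : ℕ} {α : Fin r → ZMod m} (h : IsHodge α)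
    {f : ℕ} [NeZero f] (h2 : 2 ∣ f) (hfm : f ∣ m) {χ : DirichletCharacter ℂ f} (hχ : χ.Odd)
    (hprim : χ.IsPrimitive) (M : Fin r → ℕ) [∀ i, NeZero (M i)] (hM : ∀ i, M i ∣ m)
    (w : (i : Fin r) → ZMod (M i)) (hw : ∀ i, IsUnit (w i))
    (hα : ∀ i, α i = ((m / M i : ℕ) : ZMod m) * ((ZMod.val (w i) : ℕ) : ZMod m))
    (hlev : ∀ i, f ∣ M i → M i = f ∨ M i = 2 * f) :
    ∑ i, (if M i = 2 * f then χ (ZMod.cast (w i) : ZMod f)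
      else if M i = f then 2 * χ (ZMod.cast (w i) : ZMod f) else 0) = 0 := by
  classical
  have key := h.rel_even_half h2 hfm hχ hprim M hM w hw hα hlev
  -- conjugate: `(χ y)⁻¹ = conj (χ y)`
  have hinv : ∀ y : ZMod f, (χ y)⁻¹ = starRingEnd ℂ (χ y) := by
    intro y
    by_cases hy : IsUnit y
    · exact Complex.inv_eq_conj (χ.unit_norm_eq_one hy.unit ▸ by rw [IsUnit.unit_spec])
    · rw [χ.map_nonunit hy, inv_zero, map_zero]
  have c2 : starRingEnd ℂ (2 : ℂ) = 2 := map_ofNat _ 2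
  have hterm : ∀ i, (if M i = 2 * f then χ (ZMod.cast (w i) : ZMod f)
      else if M i = f then 2 * χ (ZMod.cast (w i) : ZMod f) else 0) =
      starRingEnd ℂ (if M i = 2 * f then (χ (ZMod.cast (w i) : ZMod f))⁻¹
        else if M i = f then 2 * (χ (ZMod.cast (w i) : ZMod f))⁻¹ else 0) := by
    intro i
    by_cases h2' : M i = 2 * f
    · rw [if_pos h2', if_pos h2', map_inv₀, ← hinv, inv_inv]
    · by_cases h1 : M i = f
      · rw [if_neg h2', if_pos h1, if_neg h2', if_pos h1, map_mul, map_inv₀, c2, ← hinv, inv_inv]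
      · rw [if_neg h2', if_neg h1, if_neg h2', if_neg h1, map_zero]
  rw [Finset.sum_congr rfl fun i _ ↦ hterm i, ← map_sum, key, map_zero]

end EvenHalf

end FermatCharacter

end Literature.AlgebraicGeometry.HodgeTheory
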